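import Summits.ValiantsHypothesis.ValiantsHypothesis.Theorems.KPlusLogSqLawStaticPathOrder

/-!
# Route «KPlusLogSqLaw» — alternating folds under an ADJACENT TRANSPOSITION of two lines

HONEST FRAMING.  Helper toward the crux `WeakLifting` (item `stmt-ValiantsHypothesis-19561`, route `KPlusLogSqLaw`, cell `pub-symmetroid`,
seat val-sym-lift-p4 g8, 2026-08-27) on the line of its witness-plan stub `stub_tridiagonalSectorB` (tropical twin of the STATIC tridiagonal
sector = parametric maximum-weight independent set on a path; located theory `HOME/val-sym-lift-p4/LINEAR-LAW.md` §2–§3).  Third file of the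
record calculus (`…StaticPathRecords`: uncovered positions = common touch points of the two alternating folds; `…StaticPathOrder`: the touch
points depend only on the order of the line values).  Here, for a general family of lines `L a b 0, …, L a b n` and two parameters `θ, θ'`
between which ONLY the pair `(α, κ)`, `α < κ ≤ n`, may change order (`hord`), with pairwise distinct values at both parameters (`hdis`, `hdis'`) and
the pair ADJACENT in the value order at `θ` (`hadj`: no third line strictly between — the two sides of a simple crossing of an arrangement in
general position):
* the active index (hence every touch point) is unchanged at all levels `< κ` (`lab_eq_of_transposition_lt`), and at levels `≥ κ` the active
  indices agree modulo the pair `{α, κ}` while the touch points at levels `> κ` agree (`lab_transposition_mod_pair`); so **the touch points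
  can change only at level `κ`** (`touch_iff_of_transposition`);
* at level `κ` nothing changes unless the active index just below `κ` is `α` (`touch_larger_iff_of_ne`), in which case line `κ` touches iff it
  beats line `α` (`touch_larger_iff_gap`); and «active index below `κ` is `α`» ⟺ «`α` touches and the stretch `(α, κ)` is clean»
  (`lab_pred_eq_iff`, = val-sym-lift-p3 g6's `lab_eq_of` / `mem_I_lab`).
* (transfer) for the signed prefix-sum lines of a block, the comparison / distinctness / adjacency hypotheses pass to the REVERSED block's
  prefix-sum lines with the pair `(n-κ, n-α)` (`rev_lt_iff`, `rev_ne_of_ne`, `rev_ord_of_ord`, `rev_adj_of_adj`; from `L_rev_sub`).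
The event test for the optimal independent set (both folds at once) is in `…StaticPathEvents`.  Statements about alternating folds of lines;
nothing here asserts anything about `WeakLifting`, `TropicalB`, `KPlusLogSqLaw`, the stub in its window, `MatrixDescartes`
(stmt-ValiantsHypothesis-18050) or `VP ≠ VNP`.
-/

set_option linter.dupNamespace false
set_option autoImplicit false

namespace Summit.ValiantsHypothesis.ValiantsHypothesis.Theorems.KPlusLogSqLaw

open Finset Classical

namespace StaticPathFold

noncomputable section

variable (a b : ℕ → ℝ)

/-! ## 1. One level of the fold: the touch test and the active-index recursion -/

/-- the touch test at a successor level reads the new line against the ACTIVE line. [folklore] -/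
theorem fold_succ_eq_L_iff (k : ℕ) (θ : ℝ) :
    fold a b (k + 1) θ = L a b (k + 1) θ ↔
      (if Even (k + 1) then L a b (k + 1) θ ≤ L a b (lab a b k θ) θ else L a b (lab a b k θ) θ ≤ L a b (k + 1) θ) := by
  rw [fold_succ, fold_eq_lab a b k θ]
  split_ifs
  · exact min_eq_left_iff
  · exact max_eq_left_iff

/-- the active-index recursion. [folklore] -/
theorem lab_succ (k : ℕ) (θ : ℝ) :
    lab a b (k + 1) θ = if fold a b (k + 1) θ = L a b (k + 1) θ then k + 1 else lab a b k θ := by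
  unfold lab
  rw [Nat.findGreatest_succ]

/-! ## 2. An adjacent transposition of two lines changes the touch points only at the larger index

Throughout: between the parameters `θ` and `θ'` only the pair of lines `(α, κ)`, `α < κ ≤ n`, may change order (`hord`); the line values are
pairwise distinct at both parameters (`hdis`, `hdis'`); at `θ` no third line lies strictly between `L α` and `L κ` (`hadj`: the pair is ADJACENT
in the value order — as on the two sides of a simple crossing of an arrangement in general position). -/

section Transposition

variable {a b}
variable {n α κ : ℕ} {θ θ' : ℝ}

/-- weak comparisons of a non-special pair transfer. [folklore] -/
theorem le_iff_of_ord
    (hord : ∀ p q, p ≤ n → q ≤ n → ¬(p = α ∧ q = κ) → ¬(p = κ ∧ q = α) → (L a b p θ < L a b q θ ↔ L a b p θ' < L a b q θ'))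
    {p q : ℕ} (hp : p ≤ n) (hq : q ≤ n) (h1 : ¬(p = α ∧ q = κ)) (h2 : ¬(p = κ ∧ q = α)) :
    (L a b p θ ≤ L a b q θ ↔ L a b p θ' ≤ L a b q θ') := by
  rw [← not_lt, ← not_lt, hord q p hq hp (fun h => h2 ⟨h.2, h.1⟩) (fun h => h1 ⟨h.2, h.1⟩)]

/-- a third line is below `L α` or `L κ` at `θ` iff it is below `L α` or `L κ` (any choice) at `θ'`. [folklore] -/
theorem lt_pair_iff (hακ : α < κ) (hκn : κ ≤ n)
    (hord : ∀ p q, p ≤ n → q ≤ n → ¬(p = α ∧ q = κ) → ¬(p = κ ∧ q = α) → (L a b p θ < L a b q θ ↔ L a b p θ' < L a b q θ'))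
    (hadj : ∀ x, x ≤ n → x ≠ α → x ≠ κ → (L a b x θ < L a b α θ ↔ L a b x θ < L a b κ θ))
    {x j j' : ℕ} (hx : x ≤ n) (hxα : x ≠ α) (hxκ : x ≠ κ) (hj : j = α ∨ j = κ) (hj' : j' = α ∨ j' = κ) :
    (L a b x θ < L a b j θ ↔ L a b x θ' < L a b j' θ') := by
  have hαn : α ≤ n := hακ.le.trans hκn
  -- move `j` to `j'` at `θ` by adjacency, then transfer the non-special pair `(x, j')`
  have step1 : (L a b x θ < L a b j θ ↔ L a b x θ < L a b j' θ) := by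
    rcases hj with h | h <;> rcases hj' with h' | h' <;> rw [h, h']
    · exact hadj x hx hxα hxκ
    · exact (hadj x hx hxα hxκ).symm
  rw [step1]
  rcases hj' with h' | h' <;> rw [h']
  · exact hord x _ hx hαn (fun h => hxα h.1) (fun h => hxκ h.1)
  · exact hord x _ hx hκn (fun h => hxα h.1) (fun h => hxκ h.1)

/-- the same, above-version (uses distinctness of the values). [folklore] -/
theorem pair_lt_iff (hακ : α < κ) (hκn : κ ≤ n)
    (hord : ∀ p q, p ≤ n → q ≤ n → ¬(p = α ∧ q = κ) → ¬(p = κ ∧ q = α) → (L a b p θ < L a b q θ ↔ L a b p θ' < L a b q θ'))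
    (hdis : ∀ p q, p ≤ n → q ≤ n → p ≠ q → L a b p θ ≠ L a b q θ)
    (hdis' : ∀ p q, p ≤ n → q ≤ n → p ≠ q → L a b p θ' ≠ L a b q θ')
    (hadj : ∀ x, x ≤ n → x ≠ α → x ≠ κ → (L a b x θ < L a b α θ ↔ L a b x θ < L a b κ θ))
    {x j j' : ℕ} (hx : x ≤ n) (hxα : x ≠ α) (hxκ : x ≠ κ) (hj : j = α ∨ j = κ) (hj' : j' = α ∨ j' = κ) :
    (L a b j θ < L a b x θ ↔ L a b j' θ' < L a b x θ') := by
  have hαn : α ≤ n := hακ.le.trans hκn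
  have hjn : j ≤ n := by rcases hj with h | h <;> rw [h] <;> assumption
  have hj'n : j' ≤ n := by rcases hj' with h | h <;> rw [h] <;> assumption
  have hxj : x ≠ j := by rcases hj with h | h <;> rw [h] <;> assumption
  have hxj' : x ≠ j' := by rcases hj' with h | h <;> rw [h] <;> assumption
  have e1 : L a b j θ < L a b x θ ↔ ¬ L a b x θ < L a b j θ :=
    ⟨fun h h' => lt_asymm h h', fun h => lt_of_le_of_ne (not_lt.mp h) (hdis j x hjn hx (Ne.symm hxj))⟩
  have e2 : L a b j' θ' < L a b x θ' ↔ ¬ L a b x θ' < L a b j' θ' :=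
    ⟨fun h h' => lt_asymm h h', fun h => lt_of_le_of_ne (not_lt.mp h) (hdis' j' x hj'n hx (Ne.symm hxj'))⟩
  rw [e1, e2, lt_pair_iff hακ hκn hord hadj hx hxα hxκ hj hj']

/-- **below the larger index nothing changes**: the active indices agree at every level `x < κ`. [folklore] -/
theorem lab_eq_of_transposition_lt (hκn : κ ≤ n)
    (hord : ∀ p q, p ≤ n → q ≤ n → ¬(p = α ∧ q = κ) → ¬(p = κ ∧ q = α) → (L a b p θ < L a b q θ ↔ L a b p θ' < L a b q θ'))
    {x : ℕ} (hx : x < κ) : lab a b x θ = lab a b x θ' :=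
  lab_eq_of_order a b (n := κ - 1) (fun p q hp hq => hord p q (by omega) (by omega) (fun h => by omega) (fun h => by omega)) x
    (by omega)

/-- **above the larger index the active indices agree modulo the pair** `{α, κ}`, and the touch points agree. [folklore] -/
theorem lab_transposition_mod_pair (hακ : α < κ) (hκn : κ ≤ n)
    (hord : ∀ p q, p ≤ n → q ≤ n → ¬(p = α ∧ q = κ) → ¬(p = κ ∧ q = α) → (L a b p θ < L a b q θ ↔ L a b p θ' < L a b q θ'))
    (hdis : ∀ p q, p ≤ n → q ≤ n → p ≠ q → L a b p θ ≠ L a b q θ)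
    (hdis' : ∀ p q, p ≤ n → q ≤ n → p ≠ q → L a b p θ' ≠ L a b q θ')
    (hadj : ∀ x, x ≤ n → x ≠ α → x ≠ κ → (L a b x θ < L a b α θ ↔ L a b x θ < L a b κ θ)) :
    ∀ x, κ ≤ x → x ≤ n →
      (lab a b x θ = lab a b x θ' ∨ (lab a b x θ = α ∧ lab a b x θ' = κ) ∨ (lab a b x θ = κ ∧ lab a b x θ' = α)) ∧
        (κ < x → (fold a b x θ = L a b x θ ↔ fold a b x θ' = L a b x θ')) := by
  intro x hκx
  induction x, hκx using Nat.le_induction with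
  | base =>
    intro _
    refine ⟨?_, fun h => absurd h (lt_irrefl κ)⟩
    -- level `κ`: the previous active index `j` is common
    obtain ⟨k, hk⟩ : ∃ k, κ = k + 1 := ⟨κ - 1, by omega⟩
    have hj : lab a b k θ = lab a b k θ' := lab_eq_of_transposition_lt hκn hord (by omega)
    rw [hk, lab_succ, lab_succ, ← hj]
    by_cases hjα : lab a b k θ = α
    · -- the test at `κ` is the special comparison: each of the four outcomes is allowed
      rw [hjα]
      by_cases h1 : fold a b (k + 1) θ = L a b (k + 1) θ
      · by_cases h2 : fold a b (k + 1) θ' = L a b (k + 1) θ'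
        · rw [if_pos h1, if_pos h2]; exact Or.inl rfl
        · rw [if_pos h1, if_neg h2]; exact Or.inr (Or.inr ⟨rfl, rfl⟩)
      · by_cases h2 : fold a b (k + 1) θ' = L a b (k + 1) θ'
        · rw [if_neg h1, if_pos h2]; exact Or.inr (Or.inl ⟨rfl, rfl⟩)
        · rw [if_neg h1, if_neg h2]; exact Or.inl rfl
    · -- non-special comparison: the tests agree
      have hjk : lab a b k θ ≤ n := (lab_le a b k θ).trans (by omega)
      have htest : fold a b (k + 1) θ = L a b (k + 1) θ ↔ fold a b (k + 1) θ' = L a b (k + 1) θ' := by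
        rw [fold_succ_eq_L_iff, fold_succ_eq_L_iff, ← hj]
        have hk1 : k + 1 ≠ α := by omega
        split_ifs
        · exact le_iff_of_ord hord (by omega) hjk (fun h => hk1 h.1) (fun h => hjα h.2)
        · exact le_iff_of_ord hord hjk (by omega) (fun h => hjα h.1) (fun h => hk1 h.2)
      by_cases h1 : fold a b (k + 1) θ = L a b (k + 1) θ
      · rw [if_pos h1, if_pos (htest.mp h1)]; exact Or.inl rfl
      · rw [if_neg h1, if_neg (fun h => h1 (htest.mpr h))]; exact Or.inl rfl
  | succ x hκx ih =>
    intro hx1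
    obtain ⟨ihq, -⟩ := ih (by omega)
    have hx1α : x + 1 ≠ α := by omega
    have hx1κ : x + 1 ≠ κ := by omega
    -- the touch tests at level `x + 1` agree
    have htest : fold a b (x + 1) θ = L a b (x + 1) θ ↔ fold a b (x + 1) θ' = L a b (x + 1) θ' := by
      rw [fold_succ_eq_L_iff, fold_succ_eq_L_iff]
      have hjn : lab a b x θ ≤ n := (lab_le a b x θ).trans (by omega)
      rcases ihq with hj | ⟨hj, hj'⟩ | ⟨hj, hj'⟩
      · rw [← hj]
        split_ifs
        · exact le_iff_of_ord hord (by omega) hjn (fun h => hx1α h.1) (fun h => hx1κ h.1)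
        · exact le_iff_of_ord hord hjn (by omega) (fun h => hx1κ h.2) (fun h => hx1α h.2)
      · rw [hj, hj']
        split_ifs
        · rw [← not_lt, ← not_lt, pair_lt_iff hακ hκn hord hdis hdis' hadj hx1 hx1α hx1κ (Or.inl rfl) (Or.inr rfl)]
        · rw [← not_lt, ← not_lt, lt_pair_iff hακ hκn hord hadj hx1 hx1α hx1κ (Or.inl rfl) (Or.inr rfl)]
      · rw [hj, hj']
        split_ifs
        · rw [← not_lt, ← not_lt, pair_lt_iff hακ hκn hord hdis hdis' hadj hx1 hx1α hx1κ (Or.inr rfl) (Or.inl rfl)]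
        · rw [← not_lt, ← not_lt, lt_pair_iff hακ hκn hord hadj hx1 hx1α hx1κ (Or.inr rfl) (Or.inl rfl)]
    refine ⟨?_, fun _ => htest⟩
    rw [lab_succ, lab_succ]
    by_cases h1 : fold a b (x + 1) θ = L a b (x + 1) θ
    · rw [if_pos h1, if_pos (htest.mp h1)]; exact Or.inl rfl
    · rw [if_neg h1, if_neg (fun h => h1 (htest.mpr h))]; exact ihq

/-- **AN ADJACENT TRANSPOSITION CHANGES THE TOUCH POINTS ONLY AT THE LARGER INDEX**: for every level `x ≤ n`, `x ≠ κ`, line `x` is a touch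
point of the alternating fold at `θ` iff it is one at `θ'`. [folklore] -/
theorem touch_iff_of_transposition (hακ : α < κ) (hκn : κ ≤ n)
    (hord : ∀ p q, p ≤ n → q ≤ n → ¬(p = α ∧ q = κ) → ¬(p = κ ∧ q = α) → (L a b p θ < L a b q θ ↔ L a b p θ' < L a b q θ'))
    (hdis : ∀ p q, p ≤ n → q ≤ n → p ≠ q → L a b p θ ≠ L a b q θ)
    (hdis' : ∀ p q, p ≤ n → q ≤ n → p ≠ q → L a b p θ' ≠ L a b q θ')
    (hadj : ∀ x, x ≤ n → x ≠ α → x ≠ κ → (L a b x θ < L a b α θ ↔ L a b x θ < L a b κ θ))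
    {x : ℕ} (hx : x ≤ n) (hxκ : x ≠ κ) :
    fold a b x θ = L a b x θ ↔ fold a b x θ' = L a b x θ' := by
  rcases lt_or_gt_of_ne hxκ with h | h
  · rw [fold_eq_L_iff_lab, fold_eq_L_iff_lab, lab_eq_of_transposition_lt hκn hord h]
  · exact (lab_transposition_mod_pair hακ hκn hord hdis hdis' hadj x h.le hx).2 h

/-- **AT THE LARGER INDEX, when the active index just before `κ` is NOT `α`**, the touch test at `κ` agrees at `θ` and `θ'`. [folklore] -/
theorem touch_larger_iff_of_ne (hακ : α < κ) (hκn : κ ≤ n)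
    (hord : ∀ p q, p ≤ n → q ≤ n → ¬(p = α ∧ q = κ) → ¬(p = κ ∧ q = α) → (L a b p θ < L a b q θ ↔ L a b p θ' < L a b q θ'))
    (hjα : lab a b (κ - 1) θ ≠ α) :
    fold a b κ θ = L a b κ θ ↔ fold a b κ θ' = L a b κ θ' := by
  obtain ⟨k, hk⟩ : ∃ k, κ = k + 1 := ⟨κ - 1, by omega⟩
  have hk' : κ - 1 = k := by omega
  rw [hk'] at hjα
  have hj : lab a b k θ = lab a b k θ' := lab_eq_of_transposition_lt hκn hord (by omega)
  rw [hk, fold_succ_eq_L_iff, fold_succ_eq_L_iff, ← hj]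
  have hjk : lab a b k θ ≤ n := (lab_le a b k θ).trans (by omega)
  have hk1 : k + 1 ≠ α := by omega
  split_ifs
  · exact le_iff_of_ord hord (by omega) hjk (fun h => hk1 h.1) (fun h => hjα h.2)
  · exact le_iff_of_ord hord hjk (by omega) (fun h => hjα h.1) (fun h => hk1 h.2)

/-- **AT THE LARGER INDEX, when the active index just before `κ` IS `α`** (at a parameter `τ` with pairwise distinct line values), line `κ` is
a touch point iff it BEATS line `α`: `L κ < L α` for even `κ`, `L κ > L α` for odd `κ` — in `gap` language, line `α` would be strictly on its
correct side of line `κ` (recall `0 < gap t y z` = value `z` of line `t` correctly placed against `y` = NOT touching). [folklore] -/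
theorem touch_larger_iff_gap {τ : ℝ} (hακ : α < κ) (hκn : κ ≤ n)
    (hdis : ∀ p q, p ≤ n → q ≤ n → p ≠ q → L a b p τ ≠ L a b q τ) (hjα : lab a b (κ - 1) τ = α) :
    fold a b κ τ = L a b κ τ ↔ 0 < gap κ (L a b κ τ) (L a b α τ) := by
  obtain ⟨k, hk⟩ : ∃ k, κ = k + 1 := ⟨κ - 1, by omega⟩
  have hk' : κ - 1 = k := by omega
  rw [hk'] at hjα
  have hne : L a b (k + 1) τ ≠ L a b α τ := hdis _ _ (by omega) (by omega) (by omega)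
  rw [hk, fold_succ_eq_L_iff, hjα]
  unfold gap
  split_ifs
  · rw [sub_pos]; exact ⟨fun h => lt_of_le_of_ne h hne, le_of_lt⟩
  · rw [sub_pos]; exact ⟨fun h => lt_of_le_of_ne h (Ne.symm hne), le_of_lt⟩

/-- **the active index just before `κ` is `α` iff `α` is a touch point and every line strictly between `α` and `κ` lies strictly on its
correct side of line `α`** (the «clean stretch» condition (M) of LINEAR-LAW §2) — a restatement of val-sym-lift-p3 g6's `lab_eq_of` /
`mem_I_lab`. [folklore] -/
theorem lab_pred_eq_iff (a b : ℕ → ℝ) (hακ : α < κ) (τ : ℝ) :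
    lab a b (κ - 1) τ = α ↔ (fold a b α τ = L a b α τ ∧ τ ∈ I a b (κ - 1) α) := by
  constructor
  · intro h
    exact ⟨fold_eq_of_lab_eq a b h, h ▸ mem_I_lab a b (κ - 1) τ⟩
  · rintro ⟨h1, h2⟩
    exact lab_eq_of a b (by omega) h1 h2

end Transposition

/-! ## 3. Transfer to the REVERSED block's prefix-sum lines: comparisons, distinctness and adjacency are read off the block's -/

section RevTransfer

variable (w₁ w₀ : ℕ → ℝ)


/-- sign bookkeeping: a strict comparison multiplied by `(-1)^m` transfers when both orientations transfer. -/
theorem neg_one_pow_mul_lt_iff_of {u v u' v' : ℝ} (m : ℕ) (h1 : u < v ↔ u' < v') (h2 : v < u ↔ v' < u') :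
    ((-1 : ℝ) ^ m * u < (-1) ^ m * v ↔ (-1 : ℝ) ^ m * u' < (-1) ^ m * v') := by
  rcases neg_one_pow_eq_or ℝ m with h | h
  · rw [h, one_mul, one_mul, one_mul, one_mul]; exact h1
  · rw [h, neg_one_mul, neg_one_mul, neg_one_mul, neg_one_mul, neg_lt_neg_iff, neg_lt_neg_iff]; exact h2

/-- **comparisons of the reversed block's prefix-sum lines**: for `p, q ≤ n`,
`S'_p < S'_q ↔ (-1)^(n+1) S_(n-q) < (-1)^(n+1) S_(n-p)`. [folklore] -/
theorem rev_lt_iff {i n p q : ℕ} (hp : p ≤ n) (hq : q ≤ n) (τ : ℝ) :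
    L (altA (shift 0 (rev i n w₁))) (altB (shift 0 (rev i n w₀))) p τ < L (altA (shift 0 (rev i n w₁))) (altB (shift 0 (rev i n w₀))) q τ ↔
      (-1 : ℝ) ^ (n + 1) * L (altA (shift i w₁)) (altB (shift i w₀)) (n - q) τ <
        (-1 : ℝ) ^ (n + 1) * L (altA (shift i w₁)) (altB (shift i w₀)) (n - p) τ := by
  rw [← sub_pos, L_rev_sub w₁ w₀ (i := i) hp hq τ, mul_sub, sub_pos]

/-- distinct values of the block's prefix-sum lines give distinct values of the reversed block's. [folklore] -/
theorem rev_ne_of_ne {i n : ℕ} {τ : ℝ}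
    (hdis : ∀ p q, p ≤ n → q ≤ n → p ≠ q → L (altA (shift i w₁)) (altB (shift i w₀)) p τ ≠ L (altA (shift i w₁)) (altB (shift i w₀)) q τ) :
    ∀ p q, p ≤ n → q ≤ n → p ≠ q →
      L (altA (shift 0 (rev i n w₁))) (altB (shift 0 (rev i n w₀))) p τ ≠ L (altA (shift 0 (rev i n w₁))) (altB (shift 0 (rev i n w₀))) q τ := by
  intro p q hp hq hpq heq
  have h := L_rev_sub w₁ w₀ (i := i) hp hq τ
  rw [heq, sub_self] at h
  have hpow : ((-1 : ℝ)) ^ (n + 1) ≠ 0 := pow_ne_zero _ (by norm_num)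
  have h2 := (mul_eq_zero.mp h.symm).resolve_left hpow
  exact hdis (n - p) (n - q) (Nat.sub_le n p) (Nat.sub_le n q) (by omega) (sub_eq_zero.mp h2)

/-- **order transfer with one exceptional pair**: if all pairs of the block's prefix-sum lines other than `(α, κ)` compare the same way at `θ`
and `θ'`, then all pairs of the reversed block's prefix-sum lines other than `(n - κ, n - α)` do. [folklore] -/
theorem rev_ord_of_ord {i n α κ : ℕ} {θ θ' : ℝ} (hαn : α ≤ n) (hκn : κ ≤ n)
    (hord : ∀ p q, p ≤ n → q ≤ n → ¬(p = α ∧ q = κ) → ¬(p = κ ∧ q = α) →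
      (L (altA (shift i w₁)) (altB (shift i w₀)) p θ < L (altA (shift i w₁)) (altB (shift i w₀)) q θ ↔
        L (altA (shift i w₁)) (altB (shift i w₀)) p θ' < L (altA (shift i w₁)) (altB (shift i w₀)) q θ')) :
    ∀ p q, p ≤ n → q ≤ n → ¬(p = n - κ ∧ q = n - α) → ¬(p = n - α ∧ q = n - κ) →
      (L (altA (shift 0 (rev i n w₁))) (altB (shift 0 (rev i n w₀))) p θ < L (altA (shift 0 (rev i n w₁))) (altB (shift 0 (rev i n w₀))) q θ ↔
        L (altA (shift 0 (rev i n w₁))) (altB (shift 0 (rev i n w₀))) p θ' <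
          L (altA (shift 0 (rev i n w₁))) (altB (shift 0 (rev i n w₀))) q θ') := by
  intro p q hp hq h1 h2
  rw [rev_lt_iff w₁ w₀ hp hq, rev_lt_iff w₁ w₀ hp hq]
  refine neg_one_pow_mul_lt_iff_of (n + 1) ?_ ?_
  · exact hord (n - q) (n - p) (Nat.sub_le n q) (Nat.sub_le n p) (fun h => h2 ⟨by omega, by omega⟩) (fun h => h1 ⟨by omega, by omega⟩)
  · exact hord (n - p) (n - q) (Nat.sub_le n p) (Nat.sub_le n q) (fun h => h1 ⟨by omega, by omega⟩) (fun h => h2 ⟨by omega, by omega⟩)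

/-- **adjacency transfer**: if no third line of the block lies between `S_α` and `S_κ` at `τ` (distinct values), then no third line of the
reversed block lies between `S'_(n-κ)` and `S'_(n-α)`. [folklore] -/
theorem rev_adj_of_adj {i n α κ : ℕ} {τ : ℝ} (hαn : α ≤ n) (hκn : κ ≤ n)
    (hdis : ∀ p q, p ≤ n → q ≤ n → p ≠ q → L (altA (shift i w₁)) (altB (shift i w₀)) p τ ≠ L (altA (shift i w₁)) (altB (shift i w₀)) q τ)
    (hadj : ∀ x, x ≤ n → x ≠ α → x ≠ κ →
      (L (altA (shift i w₁)) (altB (shift i w₀)) x τ < L (altA (shift i w₁)) (altB (shift i w₀)) α τ ↔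
        L (altA (shift i w₁)) (altB (shift i w₀)) x τ < L (altA (shift i w₁)) (altB (shift i w₀)) κ τ)) :
    ∀ x, x ≤ n → x ≠ n - κ → x ≠ n - α →
      (L (altA (shift 0 (rev i n w₁))) (altB (shift 0 (rev i n w₀))) x τ < L (altA (shift 0 (rev i n w₁))) (altB (shift 0 (rev i n w₀))) (n - κ) τ ↔
        L (altA (shift 0 (rev i n w₁))) (altB (shift 0 (rev i n w₀))) x τ <
          L (altA (shift 0 (rev i n w₁))) (altB (shift 0 (rev i n w₀))) (n - α) τ) := by
  intro x hx hxκ hxα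
  rw [rev_lt_iff w₁ w₀ hx (Nat.sub_le n κ), rev_lt_iff w₁ w₀ hx (Nat.sub_le n α),
    show n - (n - κ) = κ by omega, show n - (n - α) = α by omega]
  set S := L (altA (shift i w₁)) (altB (shift i w₀)) with hS
  have hy : n - x ≤ n := Nat.sub_le n x
  have hyα : n - x ≠ α := by omega
  have hyκ : n - x ≠ κ := by omega
  have hadjy := hadj (n - x) hy hyα hyκ
  -- `S κ < S y ↔ S α < S y` from adjacency and distinctness
  have hflip : (S κ τ < S (n - x) τ ↔ S α τ < S (n - x) τ) := by
    have e1 : S κ τ < S (n - x) τ ↔ ¬ S (n - x) τ < S κ τ :=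
      ⟨fun h h' => lt_asymm h h', fun h => lt_of_le_of_ne (not_lt.mp h) (hdis κ (n - x) hκn hy (Ne.symm hyκ))⟩
    have e2 : S α τ < S (n - x) τ ↔ ¬ S (n - x) τ < S α τ :=
      ⟨fun h h' => lt_asymm h h', fun h => lt_of_le_of_ne (not_lt.mp h) (hdis α (n - x) hαn hy (Ne.symm hyα))⟩
    rw [e1, e2, hadjy]
  rcases neg_one_pow_eq_or ℝ (n + 1) with h | h
  · rw [h, one_mul, one_mul, one_mul]; exact hflip
  · rw [h, neg_one_mul, neg_one_mul, neg_one_mul, neg_lt_neg_iff, neg_lt_neg_iff]; exact hadjy.symm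

end RevTransfer

end

end StaticPathFold

end Summit.ValiantsHypothesis.ValiantsHypothesis.Theorems.KPlusLogSqLaw
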